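import Literature.Topology.FourManifolds.PlanePush
import Literature.Topology.FourManifolds.GenericMapNormalForms
import HarnessLib

/-!
# The general push of a map into a surface along a chart of the target

Topic `Literature/Topology/FourManifolds` (programme of the fact
`Literature.Topology.FourManifolds.exists_isSimplifiedBrokenLefschetzFibration`, Baykur–Saeki 2017, §2.1,
§3: isotoping pieces of the singular image of a generic map).  Let `g : X → B` be `C^∞`,
`ψ` a smooth chart of `B`, `b : X → ℝ` a `C^∞` compactly supported function with
`tsupport b ⊆ g⁻¹(ψ.source)` and `|b| ≤ 1`, and `θ ∈ ℝ²`.  The **pushed map**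

  `g_θ(q) = ψ⁻¹(ψ(g q) + b(q) θ)`  (`g q ∈ ψ.source`),   `g_θ = g` elsewhere,

is `C^∞`, equals `g` off `tsupport b`, and reads `ψ ∘ g_θ = ψ ∘ g + b θ` over `ψ.source`.
If moreover `b = ρ ∘ ψ ∘ g` on an open set `V` containing the critical points of `g` in
`tsupport b` (`ρ : ℝ² → ℝ` smooth with `‖dρ‖ ≤ C`), then on `V` the pushed map FACTORS as
`g_θ = ψ⁻¹ ∘ T_θ ∘ ψ ∘ g` through the plane push `T_θ(w) = w + ρ(w)θ` (`PlanePush`), an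
injective local diffeomorphism for `C‖θ‖ < 1`; consequently, for `‖θ‖` small, `g_θ` has the
SAME critical set as `g` (on `V` by the factorisation, on the compact rest of the support by
openness of submersivity jointly in `(θ, q)`, elsewhere because `g_θ = g`).  This is the form
of the push that can be iterated along the normal-crossing induction (no normal form of `g` is
needed) and that also serves near cusps.

* `GeneralPush.pushed`, `exists_margin`, `apply_pushed`, `pushed_eq_symm_T`, `contMDiff_pushed`,
  `exists_surjective_mfderiv_pushed_iff`.

Everything is proved; `pushed` is the only definition; no named facts (D-0026).

## References

* R. İ. Baykur, O. Saeki, *Simplifying indefinite fibrations on 4-manifolds*, arXiv:1705.11169,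
  §2.1 p. 6, §3. [BaykurSaeki2017]
* M. Golubitsky, V. Guillemin, *Stable Mappings and Their Singularities*, GTM 14 (1973), Ch. III
  §4. [GolubitskyGuillemin1973]
-/

noncomputable section

set_option maxSynthPendingDepth 2

open Set Function Filter Module Metric
open scoped ContDiff Topology Manifold

namespace Literature.Topology.FourManifolds

/-- Local notation: `𝔼 n` is the model Euclidean space `EuclideanSpace ℝ (Fin n)`. -/
local notation "𝔼 " n:arg => EuclideanSpace ℝ (Fin n)

namespace GeneralPush

variable {X : Type*} [TopologicalSpace X] [ChartedSpace (𝔼 4) X]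
  {B : Type*} [TopologicalSpace B] [ChartedSpace (𝔼 2) B]

/-- **The pushed map** `g_θ = ψ⁻¹(ψ ∘ g + b θ)` over `ψ.source`, `g` elsewhere.
[cite: BaykurSaeki2017, §3] -/
def pushed (g : X → B) (ψ : OpenPartialHomeomorph B (𝔼 2)) (b : X → ℝ) (θ : 𝔼 2) : X → B := by
  classical
  exact (g ⁻¹' ψ.source).piecewise (fun q => ψ.symm (ψ (g q) + b q • θ)) g

variable {g : X → B} {ψ : OpenPartialHomeomorph B (𝔼 2)} {b : X → ℝ} {θ : 𝔼 2}

omit [TopologicalSpace X] [ChartedSpace (𝔼 4) X] [ChartedSpace (𝔼 2) B] in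
/-- Over `ψ.source`. [folklore] -/
theorem pushed_of_mem {q : X} (hq : g q ∈ ψ.source) :
    pushed g ψ b θ q = ψ.symm (ψ (g q) + b q • θ) := by
  classical
  unfold pushed
  exact piecewise_eq_of_mem _ _ _ hq

omit [TopologicalSpace X] [ChartedSpace (𝔼 4) X] [ChartedSpace (𝔼 2) B] in
/-- Off `g⁻¹(ψ.source)`. [folklore] -/
theorem pushed_of_notMem {q : X} (hq : g q ∉ ψ.source) : pushed g ψ b θ q = g q := by
  classical
  unfold pushed
  exact piecewise_eq_of_notMem (g ⁻¹' ψ.source) _ _ hq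

omit [ChartedSpace (𝔼 4) X] [ChartedSpace (𝔼 2) B] in
/-- **Off `tsupport b` the pushed map is `g`.** [folklore] -/
theorem pushed_eq_of_notMem_tsupport {q : X} (hq : q ∉ tsupport b) : pushed g ψ b θ q = g q := by
  by_cases hqs : g q ∈ ψ.source
  · rw [pushed_of_mem hqs, image_eq_zero_of_notMem_tsupport hq, zero_smul, add_zero,
      ψ.left_inv hqs]
  · exact pushed_of_notMem hqs

omit [ChartedSpace (𝔼 4) X] [ChartedSpace (𝔼 2) B] in
/-- The pushed map agrees with `g` near every point off `tsupport b`. [folklore] -/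
theorem pushed_eventuallyEq_of_notMem_tsupport {q : X} (hq : q ∉ tsupport b) :
    pushed g ψ b θ =ᶠ[𝓝 q] g :=
  eventually_of_mem ((isClosed_tsupport b).isOpen_compl.mem_nhds hq)
    fun _ hq' => pushed_eq_of_notMem_tsupport hq'

omit [ChartedSpace (𝔼 4) X] [ChartedSpace (𝔼 2) B] in
/-- **Margin**: for `‖θ‖` small, `ψ(g q) + b(q)θ ∈ ψ.target` whenever `g q ∈ ψ.source`.
[folklore] -/
theorem exists_margin (hgc : Continuous g) (hbs : HasCompactSupport b)
    (hbt : tsupport b ⊆ g ⁻¹' ψ.source) (hb1 : ∀ q, |b q| ≤ 1) :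
    ∃ δ > 0, ∀ θ : 𝔼 2, ‖θ‖ < δ → ∀ q, g q ∈ ψ.source → ψ (g q) + b q • θ ∈ ψ.target := by
  set K2 : Set (𝔼 2) := ψ '' (g '' tsupport b) with hK2
  have hK1 : IsCompact (g '' tsupport b) := hbs.image hgc
  have hK1s : g '' tsupport b ⊆ ψ.source := by
    rintro _ ⟨q, hq, rfl⟩; exact hbt hq
  have hK2c : IsCompact K2 := hK1.image_of_continuousOn (ψ.continuousOn.mono hK1s)
  have hK2t : K2 ⊆ ψ.target := by
    rintro _ ⟨v, hv, rfl⟩; exact ψ.map_source (hK1s hv)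
  obtain ⟨δ, hδ, hthick⟩ := hK2c.exists_cthickening_subset_open ψ.open_target hK2t
  refine ⟨δ, hδ, fun θ hθ q hq => ?_⟩
  by_cases hqt : q ∈ tsupport b
  · apply hthick
    refine Metric.mem_cthickening_of_dist_le _ (ψ (g q)) _ _ ⟨g q, ⟨q, hqt, rfl⟩, rfl⟩ ?_
    rw [dist_eq_norm, add_sub_cancel_left, norm_smul, Real.norm_eq_abs]
    calc |b q| * ‖θ‖ ≤ 1 * ‖θ‖ := by gcongr; exact hb1 q
      _ ≤ δ := by rw [one_mul]; exact hθ.le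
  · rw [image_eq_zero_of_notMem_tsupport hqt, zero_smul, add_zero]
    exact ψ.map_source hq

omit [TopologicalSpace X] [ChartedSpace (𝔼 4) X] [ChartedSpace (𝔼 2) B] in
/-- **Values over `ψ.source`**: `g_θ q ∈ ψ.source` and `ψ (g_θ q) = ψ (g q) + b(q) θ`. [folklore] -/
theorem apply_pushed (hθt : ∀ q, g q ∈ ψ.source → ψ (g q) + b q • θ ∈ ψ.target) {q : X}
    (hq : g q ∈ ψ.source) :
    pushed g ψ b θ q ∈ ψ.source ∧ ψ (pushed g ψ b θ q) = ψ (g q) + b q • θ := by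
  rw [pushed_of_mem hq]
  exact ⟨ψ.map_target (hθt q hq), ψ.right_inv (hθt q hq)⟩

omit [TopologicalSpace X] [ChartedSpace (𝔼 4) X] [ChartedSpace (𝔼 2) B] in
/-- **Factorisation on `V`**: where `b = ρ ∘ ψ ∘ g`, `g_θ = ψ⁻¹ ∘ T_θ ∘ ψ ∘ g`. [folklore] -/
theorem pushed_eq_symm_T {ρ : 𝔼 2 → ℝ} {V : Set X} (hVs : V ⊆ g ⁻¹' ψ.source)
    (hVb : ∀ q ∈ V, b q = ρ (ψ (g q))) {q : X} (hq : q ∈ V) :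
    pushed g ψ b θ q = ψ.symm (PlanePush.T ρ θ (ψ (g q))) := by
  rw [pushed_of_mem (hVs hq), hVb q hq, PlanePush.T]

/-- **The pushed map is `C^∞`.** [cite: BaykurSaeki2017, §3] -/
theorem contMDiff_pushed (hg : ContMDiff (𝓡 4) (𝓡 2) ∞ g)
    (hψ : ContMDiffOn (𝓡 2) (𝓡 2) ∞ ψ ψ.source) (hψs : ContMDiffOn (𝓡 2) (𝓡 2) ∞ ψ.symm ψ.target)
    (hb : ContMDiff (𝓡 4) 𝓘(ℝ, ℝ) ∞ b) (hbt : tsupport b ⊆ g ⁻¹' ψ.source)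
    (hθt : ∀ q, g q ∈ ψ.source → ψ (g q) + b q • θ ∈ ψ.target) :
    ContMDiff (𝓡 4) (𝓡 2) ∞ (pushed g ψ b θ) := by
  set S : Set X := g ⁻¹' ψ.source with hS
  have hSo : IsOpen S := ψ.open_source.preimage hg.continuous
  have h1 : ContMDiffOn (𝓡 4) (𝓡 2) ∞ (fun q => ψ (g q)) S :=
    hψ.comp hg.contMDiffOn fun q hq => hq
  have hinner : ContMDiffOn (𝓡 4) (𝓡 2) ∞ (fun q => ψ (g q) + b q • θ) S :=
    h1.add (hb.contMDiffOn.smul contMDiffOn_const)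
  have hPon : ContMDiffOn (𝓡 4) (𝓡 2) ∞ (pushed g ψ b θ) S :=
    (hψs.comp hinner fun q hq => hθt q hq).congr fun q hq => pushed_of_mem hq
  intro q
  by_cases hq : q ∈ S
  · exact (hPon q hq).contMDiffAt (hSo.mem_nhds hq)
  · have hqt : q ∉ tsupport b := fun h => hq (hbt h)
    exact (hg q).congr_of_eventuallyEq (pushed_eventuallyEq_of_notMem_tsupport hqt)

/-! ### The critical set is unchanged -/

omit [ChartedSpace (𝔼 4) X] [ChartedSpace (𝔼 2) B] in
/-- The local representative of the pushed map in a chart `Φ₀` of `X` with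
`Φ₀.source ⊆ g⁻¹(ψ.source)`: `ψ ∘ g_θ ∘ Φ₀⁻¹ = ψ ∘ g ∘ Φ₀⁻¹ + (b ∘ Φ₀⁻¹) θ` on `Φ₀.target`.
[folklore] -/
theorem rep_pushed_eq {Φ₀ : OpenPartialHomeomorph X (𝔼 4)} (hΦ₀ : Φ₀.source ⊆ g ⁻¹' ψ.source)
    (hθt : ∀ q, g q ∈ ψ.source → ψ (g q) + b q • θ ∈ ψ.target) {y : 𝔼 4} (hy : y ∈ Φ₀.target) :
    (ψ ∘ pushed g ψ b θ ∘ Φ₀.symm) y = (ψ ∘ g ∘ Φ₀.symm) y + b (Φ₀.symm y) • θ := by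
  simp only [Function.comp_apply]
  exact (apply_pushed hθt (hΦ₀ (Φ₀.map_target hy))).2

/-- **The general push does not change the critical set.**  With `g`, `ψ`, `b` as above, if
`b = ρ ∘ ψ ∘ g` on an open `V ⊆ g⁻¹(ψ.source)` containing every critical point of `g` lying in
`tsupport b` (`ρ` smooth, `‖dρ‖ ≤ C`), then for `‖θ‖` small `g_θ` and `g` have the same
critical points. [cite: BaykurSaeki2017, §2.1 p. 6, §3] -/
theorem exists_surjective_mfderiv_pushed_iff [T2Space X] [IsManifold (𝓡 4) ∞ X]
    (hg : ContMDiff (𝓡 4) (𝓡 2) ∞ g)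
    (hψ : ContMDiffOn (𝓡 2) (𝓡 2) ∞ ψ ψ.source) (hψs : ContMDiffOn (𝓡 2) (𝓡 2) ∞ ψ.symm ψ.target)
    (hb : ContMDiff (𝓡 4) 𝓘(ℝ, ℝ) ∞ b) (hbs : HasCompactSupport b)
    (hbt : tsupport b ⊆ g ⁻¹' ψ.source) (hb1 : ∀ q, |b q| ≤ 1)
    {ρ : 𝔼 2 → ℝ} (hρ : ContDiff ℝ ∞ ρ) {C : ℝ} (hC0 : 0 ≤ C) (hC : ∀ w, ‖fderiv ℝ ρ w‖ ≤ C)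
    {V : Set X} (hV : IsOpen V) (hVs : V ⊆ g ⁻¹' ψ.source) (hVb : ∀ q ∈ V, b q = ρ (ψ (g q)))
    (hcrit : ∀ q ∈ tsupport b, ¬ Surjective (mfderiv (𝓡 4) (𝓡 2) g q) → q ∈ V) :
    ∃ ε > 0, ∀ θ : 𝔼 2, ‖θ‖ < ε → ∀ q,
      (Surjective (mfderiv (𝓡 4) (𝓡 2) (pushed g ψ b θ) q) ↔
        Surjective (mfderiv (𝓡 4) (𝓡 2) g q)) := by
  obtain ⟨δ, hδ, hmargin⟩ := exists_margin hg.continuous hbs hbt hb1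
  set S : Set X := g ⁻¹' ψ.source with hS
  have hSo : IsOpen S := ψ.open_source.preimage hg.continuous
  -- charts of `X` restricted to an open set, and the representative of `g`
  have chart_data : ∀ (q₀ : X) (W : Set X), IsOpen W → q₀ ∈ W → W ⊆ S →
      ∃ Φ₀ : OpenPartialHomeomorph X (𝔼 4), q₀ ∈ Φ₀.source ∧ Φ₀.source ⊆ W ∧
        ContMDiffOn (𝓡 4) (𝓡 4) ∞ Φ₀ Φ₀.source ∧ ContMDiffOn (𝓡 4) (𝓡 4) ∞ Φ₀.symm Φ₀.target ∧
        MapsTo g Φ₀.source ψ.source ∧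
        ContDiffOn ℝ ∞ (ψ ∘ g ∘ Φ₀.symm) Φ₀.target := by
    intro q₀ W hW hq₀ hWS
    refine ⟨(chartAt (𝔼 4) q₀).restrOpen W hW, ⟨mem_chart_source _ q₀, hq₀⟩,
      inter_subset_right, ?_, ?_, fun q hq => hWS hq.2, ?_⟩
    · exact (contMDiffOn_chart (x := q₀)).mono inter_subset_left
    · exact (contMDiffOn_chart_symm (x := q₀)).mono fun y hy => hy.1
    · have hmaps : MapsTo g ((chartAt (𝔼 4) q₀).restrOpen W hW).source ψ.source :=
        fun q hq => hWS hq.2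
      exact contMDiffOn_iff_contDiffOn.1 (hψ.comp
        (hg.comp_contMDiffOn ((contMDiffOn_chart_symm (x := q₀)).mono fun y hy => hy.1))
        fun y hy => hmaps (OpenPartialHomeomorph.map_target _ hy))
  -- Region B: the compact part of the support off `V`
  set Z : Set X := tsupport b ∩ Vᶜ with hZ
  have hZc : IsCompact Z := hbs.inter_right hV.isClosed_compl
  have hB : ∀ᶠ θ in 𝓝 (0 : 𝔼 2), ∀ q ∈ Z,
      Surjective (mfderiv (𝓡 4) (𝓡 2) (pushed g ψ b θ) q) := by
    refine hZc.eventually_forall_of_forall_eventually fun q₀ hq₀ => ?_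
    have hq₀S : q₀ ∈ S := hbt hq₀.1
    obtain ⟨Φ₀, hq₀Φ, hΦS, hΦ₀, hΦ₀s, hmaps, hrep⟩ := chart_data q₀ S hSo hq₀S Subset.rfl
    set R : 𝔼 4 → 𝔼 2 := ψ ∘ g ∘ Φ₀.symm with hR
    set bb : 𝔼 4 → ℝ := b ∘ Φ₀.symm with hbb
    have hbbs : ContDiffOn ℝ ∞ bb Φ₀.target :=
      contMDiffOn_iff_contDiffOn.1 (hb.comp_contMDiffOn hΦ₀s)
    -- the joint differential and its surjectivity near `(0, Φ₀ q₀)`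
    set D : 𝔼 2 × 𝔼 4 → 𝔼 4 →L[ℝ] 𝔼 2 := fun p =>
      fderiv ℝ R p.2 + (fderiv ℝ bb p.2).smulRight p.1 with hD
    have hDc : ContinuousOn D ((univ : Set (𝔼 2)) ×ˢ Φ₀.target) := by
      have h1 : ContinuousOn (fun p : 𝔼 2 × 𝔼 4 => fderiv ℝ R p.2) ((univ : Set (𝔼 2)) ×ˢ Φ₀.target) :=
        (hrep.continuousOn_fderiv_of_isOpen Φ₀.open_target (by simp)).comp continuousOn_snd
          fun p hp => hp.2
      have h2 : ContinuousOn (fun p : 𝔼 2 × 𝔼 4 => fderiv ℝ bb p.2)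
          ((univ : Set (𝔼 2)) ×ˢ Φ₀.target) :=
        (hbbs.continuousOn_fderiv_of_isOpen Φ₀.open_target (by simp)).comp continuousOn_snd
          fun p hp => hp.2
      have h3 := (ContinuousLinearMap.smulRightL ℝ (𝔼 4) (𝔼 2)).continuous₂.comp_continuousOn
        (h2.prodMk continuousOn_fst)
      have h4 : ContinuousOn (fun p : 𝔼 2 × 𝔼 4 => (fderiv ℝ bb p.2).smulRight p.1)
          ((univ : Set (𝔼 2)) ×ˢ Φ₀.target) :=
        h3.congr fun p _ => by simp [Function.comp, Function.uncurry]
      exact h1.add h4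
    have hOpen : IsOpen {p ∈ (univ : Set (𝔼 2)) ×ˢ Φ₀.target | Surjective (D p)} :=
      isOpen_inter_setOf_surjective (isOpen_univ.prod Φ₀.open_target) hDc
    have hreg : Surjective (mfderiv (𝓡 4) (𝓡 2) g q₀) := by
      by_contra hns; exact hq₀.2 (hcrit q₀ hq₀.1 hns)
    have hy₀ : Φ₀ q₀ ∈ Φ₀.target := Φ₀.map_source hq₀Φ
    have hRd : ∀ y ∈ Φ₀.target, HasFDerivAt R (fderiv ℝ R y) y := fun y hy =>
      ((hrep.contDiffAt (Φ₀.open_target.mem_nhds hy)).differentiableAt (by simp)).hasFDerivAt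
    have hbbd : ∀ y ∈ Φ₀.target, HasFDerivAt bb (fderiv ℝ bb y) y := fun y hy =>
      ((hbbs.contDiffAt (Φ₀.open_target.mem_nhds hy)).differentiableAt (by simp)).hasFDerivAt
    have hD0 : Surjective (D (0, Φ₀ q₀)) := by
      have h0 : D (0, Φ₀ q₀) = fderiv ℝ R (Φ₀ q₀) := by
        simp only [hD]
        rw [show (fderiv ℝ bb (Φ₀ q₀)).smulRight (0 : 𝔼 2) = 0 by ext v; simp, add_zero]
      rw [h0, ← surjective_mfderiv_iff_of_localRepresentative hΦ₀ hΦ₀s hψ hψs hmaps hq₀Φ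
        (hRd _ hy₀).differentiableAt (Eventually.of_forall fun _ => rfl)]
      exact hreg
    have hmem : ((0 : 𝔼 2), Φ₀ q₀) ∈ {p ∈ (univ : Set (𝔼 2)) ×ˢ Φ₀.target | Surjective (D p)} :=
      ⟨⟨mem_univ _, hy₀⟩, hD0⟩
    -- pull back along `(θ, q) ↦ (θ, Φ₀ q)`
    have hcont : ContinuousAt (fun z : 𝔼 2 × X => (z.1, Φ₀ z.2)) (0, q₀) :=
      continuousAt_fst.prodMk ((Φ₀.continuousAt hq₀Φ).comp continuousAt_snd)
    have hev1 : ∀ᶠ z : 𝔼 2 × X in 𝓝 (0, q₀), Surjective (D (z.1, Φ₀ z.2)) := by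
      have := hcont.preimage_mem_nhds (hOpen.mem_nhds hmem)
      filter_upwards [this] with z hz
      exact hz.2
    have hev2 : ∀ᶠ z : 𝔼 2 × X in 𝓝 (0, q₀), z.2 ∈ Φ₀.source ∧ ‖z.1‖ < δ := by
      have h1 : ∀ᶠ z : 𝔼 2 × X in 𝓝 (0, q₀), z.2 ∈ Φ₀.source :=
        (continuousAt_snd (p := ((0 : 𝔼 2), q₀))).preimage_mem_nhds
          (Φ₀.open_source.mem_nhds hq₀Φ)
      have h2 : ∀ᶠ z : 𝔼 2 × X in 𝓝 (0, q₀), ‖z.1‖ < δ := by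
        have : ∀ᶠ θ : 𝔼 2 in 𝓝 0, ‖θ‖ < δ := by
          filter_upwards [Metric.ball_mem_nhds (0 : 𝔼 2) hδ] with θ hθ
          simpa using hθ
        exact (continuousAt_fst (p := ((0 : 𝔼 2), q₀))).eventually this
      exact h1.and h2
    filter_upwards [hev1, hev2] with z hz1 hz2
    obtain ⟨θ, q⟩ := z
    obtain ⟨hq, hθ⟩ := hz2
    have hθt := hmargin θ hθ
    -- the representative of `g_θ` near `Φ₀ q`
    have hPmaps : MapsTo (pushed g ψ b θ) Φ₀.source ψ.source := fun q' hq' =>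
      (apply_pushed hθt (hmaps hq')).1
    have hGd : HasFDerivAt (fun y => R y + bb y • θ) (D (θ, Φ₀ q)) (Φ₀ q) :=
      (hRd _ (Φ₀.map_source hq)).add ((hbbd _ (Φ₀.map_source hq)).smul_const θ)
    have hGf : (fun y => R y + bb y • θ) =ᶠ[𝓝 (Φ₀ q)] (ψ ∘ pushed g ψ b θ ∘ Φ₀.symm) :=
      eventually_of_mem (Φ₀.open_target.mem_nhds (Φ₀.map_source hq)) fun y hy =>
        (rep_pushed_eq (fun q' hq' => hmaps hq') hθt hy).symm
    rw [surjective_mfderiv_iff_of_localRepresentative hΦ₀ hΦ₀s hψ hψs hPmaps hq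
      hGd.differentiableAt hGf, hGd.fderiv]
    exact hz1
  obtain ⟨εB, hεB, hballB⟩ := Metric.eventually_nhds_iff.1 hB
  -- the three constants
  refine ⟨min (min δ (1 / (C + 1))) εB, lt_min (lt_min hδ (by positivity)) hεB, fun θ hθ q => ?_⟩
  have hθδ : ‖θ‖ < δ := lt_of_lt_of_le hθ ((min_le_left _ _).trans (min_le_left _ _))
  have hθC : C * ‖θ‖ < 1 := by
    have h1 : ‖θ‖ < 1 / (C + 1) := lt_of_lt_of_le hθ ((min_le_left _ _).trans (min_le_right _ _))
    rw [lt_div_iff₀ (by positivity)] at h1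
    nlinarith [norm_nonneg θ]
  have hθB : dist θ 0 < εB := by rw [dist_zero_right]; exact lt_of_lt_of_le hθ (min_le_right _ _)
  have hθt := hmargin θ hθδ
  by_cases hqV : q ∈ V
  · -- Region A: the factorisation through `T_θ`
    obtain ⟨Φ₀, hqΦ, hΦV, hΦ₀, hΦ₀s, hmaps, hrep⟩ := chart_data q V hV hqV hVs
    set R : 𝔼 4 → 𝔼 2 := ψ ∘ g ∘ Φ₀.symm with hR
    have hy : Φ₀ q ∈ Φ₀.target := Φ₀.map_source hqΦ
    have hRd : HasFDerivAt R (fderiv ℝ R (Φ₀ q)) (Φ₀ q) :=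
      ((hrep.contDiffAt (Φ₀.open_target.mem_nhds hy)).differentiableAt (by simp)).hasFDerivAt
    have hPmaps : MapsTo (pushed g ψ b θ) Φ₀.source ψ.source := fun q' hq' =>
      (apply_pushed hθt (hmaps hq')).1
    have hGd : HasFDerivAt (PlanePush.T ρ θ ∘ R)
        ((PlanePush.TDeriv ρ θ (R (Φ₀ q))).comp (fderiv ℝ R (Φ₀ q))) (Φ₀ q) :=
      (PlanePush.hasFDerivAt_T hρ θ _).comp _ hRd
    have hGf : (PlanePush.T ρ θ ∘ R) =ᶠ[𝓝 (Φ₀ q)] (ψ ∘ pushed g ψ b θ ∘ Φ₀.symm) := by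
      refine eventually_of_mem (Φ₀.open_target.mem_nhds hy) fun y hy' => ?_
      have hq' : Φ₀.symm y ∈ V := hΦV (Φ₀.map_target hy')
      simp only [Function.comp_apply]
      rw [(apply_pushed hθt (hVs hq')).2, hVb _ hq', PlanePush.T]
      rfl
    rw [surjective_mfderiv_iff_of_localRepresentative hΦ₀ hΦ₀s hψ hψs hPmaps hqΦ
      hGd.differentiableAt hGf, hGd.fderiv,
      surjective_mfderiv_iff_of_localRepresentative hΦ₀ hΦ₀s hψ hψs hmaps hqΦ
      hRd.differentiableAt (Eventually.of_forall fun _ => rfl), ContinuousLinearMap.coe_comp]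
    have hbij := PlanePush.bijective_TDeriv hC hθC (R (Φ₀ q))
    exact ⟨fun h => (Surjective.of_comp_iff' hbij _).1 h, fun h => hbij.2.comp h⟩
  · by_cases hqt : q ∈ tsupport b
    · -- Region B
      have hreg : Surjective (mfderiv (𝓡 4) (𝓡 2) g q) := by
        by_contra hns; exact hqV (hcrit q hqt hns)
      exact ⟨fun _ => hreg, fun _ => hballB hθB q ⟨hqt, hqV⟩⟩
    · -- Region C
      rw [(pushed_eventuallyEq_of_notMem_tsupport (θ := θ) hqt).mfderiv_eq]
      exact Iff.rfl

end GeneralPush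

end Literature.Topology.FourManifolds
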